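import Mathlib
import Literature.NumberTheory.LFunctions.Zhang2022.Section4Statements
import Literature.NumberTheory.LFunctions.Zhang2022.SkeletonAssembly
import Literature.NumberTheory.LFunctions.Zhang2022.Section2Lemma23Inputs
import Literature.NumberTheory.LFunctions.Zhang2022.Section6LFunctionStripGrowth
import Literature.Analysis.Complex.VerticalLineShiftPoles
import HarnessLib

/-!
# Zhang (2022) §4, proof of Lemma 4.4: "By the residue theorem,
# `L(s,ψ)L(s,ψχ) = (2πi)⁻¹(∫_{(1)} − ∫_{(−σ−1/2)}) L(s+w,ψ)L(s+w,ψχ)P^{(9/5)w}ω₁(w)dw/w`"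
# (DAG node `Z22:§4.u025`), DISCHARGED

Topic `Literature/NumberTheory/LFunctions/Zhang2022` (Landau–Siegel audit tree; verdict-neutral).
Y. Zhang, *Discrete mean estimates and the Landau–Siegel zero*, arXiv:2211.02515v1 (2022)
[Zhang2022LandauSiegel] — **an unrefereed manuscript under adjudication; nothing here asserts or
denies its Theorems 1–2 or anything about Landau–Siegel zeros.** Campaign D-0069, discharge lane
(seat sz-d08), node `Z22:§4.u025` [Z22 p.19, tex L1050], typed statement-exact by L1-t3 as
`Section4.ResidueSplit` (`Section4Statements.lean`):

> *Proof* [of Lemma 4.4]. By the residue theorem,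
> `L(s,ψ)L(s,ψχ) = (2πi)⁻¹(∫_{(1)} − ∫_{(−σ−1/2)}) L(s+w,ψ)L(s+w,ψχ)P^{(9/5)w}ω₁(w)dw/w`
> for `s ∈ Ω₃`.

This file PROVES that display as typed (`residueSplit_holds : Section4.ResidueSplit`), and in fact the
identity for EVERY `s` with `−σ − 1/2 < 0` (in particular on `Ω₃`, where `σ > 1/2 − α`), every
`D ≥ 3` and every real primitive `χ (mod D)`, `ψ (mod p) ∈ Ψ` (`perronLine_LL_one_sub_eq`). The
mechanism is the one of the tree's `Section6Shift.vline_integrandL_one_eq` (sz-d26, the §6 twin of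
this step), transplanted: the residue theorem for vertical lines
`Literature.Analysis.Complex.integral_vertical_sub_eq_sum_of_poles` between `Re w = 1` and
`Re w = −σ − 1/2`; the integrand `F(w) = L(s+w,ψ)L(s+w,ψχ)P^{(9/5)w}ω₁(w)/w` is meromorphic with a
single simple pole at `w = 0` (both `L(·,ψ)` and `L(·,ψχ)` are entire: `ψ`, `ψχ` are non-principal,
`ψχ` being primitive to the modulus `Dp` by `Skeleton.psiChiPrimitive_holds`; non-principal: `Skeleton.psiChi_ne_one`), residue
`L(s,ψ)L(s,ψχ)`; it is integrable along every line `Re w = u`, `0 < |u| ≤ 2`, and uniformly small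
on the horizontal segments, because `|ω₁(u+iv)| = e^{(u²−v²)/4𝓛³⁰}` (`GaussWeight.norm_omega1`)
decays like a Gaussian while `L(s+w,ψ)L(s+w,ψχ)` grows at most polynomially in `|Im w|` on the
strip (the tree's `StripGrowth.exists_norm_LFunction_le_pow`, MV Cor. 10.10, applied to both factors).

| decl | content |
|---|---|
| `exists_norm_perronLL_mul_le` | `‖F(u+iv)‖·|u+iv| ≤ K(1+|v|)ᴺe^{−bv²}` on `|u| ≤ 2`, majorant integrable |
| `integrable_perronLL_line` | `v ↦ F(u+iv)` integrable for `0 < |u| ≤ 2` |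
| `perronLine_LL_one_sub_eq` | `D ≥ 3`, `χ` primitive, `x : Chr D`, `−2 ≤ σ₁ < 0`: `perronLine 1 − perronLine σ₁ = L(s,ψ)L(s,ψχ)` |
| `residueSplit_holds` | **`Section4.ResidueSplit` holds** (node `Z22:§4.u025` discharged) |

No new definitions, no facts. WHAT THIS IS NOT: a discharge of (4.7)–(4.9) or of Lemma 4.4.

## References

* Y. Zhang, arXiv:2211.02515v1 (2022), §4 p. 19 (proof of Lemma 4.4, tex L1048–1052); §4 p. 18
  (`ω₁`). [cite: Zhang2022LandauSiegel, §4 Lemma 4.4 (proof) p.19]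
* H. L. Montgomery, R. C. Vaughan, *Multiplicative Number Theory I*, CUP 2007, §10.1 Cor. 10.10
  (through `Section6LFunctionStripGrowth`). [cite: MontgomeryVaughan2007, §10.1 Cor. 10.10]
-/

noncomputable section

open Complex Real MeasureTheory Filter Set
open scoped Topology

namespace Literature.NumberTheory.LFunctions.Zhang2022.Section4ResidueShift

open Skeleton Section4

/-! ### §1. Plumbing: a Gaussian moment is integrable -/

/-- `(1 + |v|)ᴺ e^{−bv²}` is integrable on `ℝ` for `b > 0`. [folklore] -/
private theorem integrable_one_add_abs_pow_mul_exp_neg_mul_sq {b : ℝ} (hb : 0 < b) (N : ℕ) :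
    Integrable fun v : ℝ => (1 + |v|) ^ N * Real.exp (-b * v ^ 2) := by
  have h0 : Integrable fun v : ℝ => Real.exp (-b * v ^ 2) := integrable_exp_neg_mul_sq hb
  have hN : Integrable fun v : ℝ => v ^ (N : ℝ) * Real.exp (-b * v ^ 2) :=
    integrable_rpow_mul_exp_neg_mul_sq hb (by linarith [N.cast_nonneg (α := ℝ)])
  have hN' : Integrable fun v : ℝ => |v| ^ N * Real.exp (-b * v ^ 2) := by
    refine hN.norm.congr (ae_of_all _ fun v => ?_)
    simp only [norm_mul, Real.norm_eq_abs, Real.rpow_natCast, abs_pow, Real.abs_exp]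
  have hsum := (h0.add hN').const_mul ((2 : ℝ) ^ N)
  refine hsum.mono' ?_ (ae_of_all _ fun v => ?_)
  · have hc : Continuous fun v : ℝ => (1 + |v|) ^ N * Real.exp (-b * v ^ 2) := by fun_prop
    exact hc.aestronglyMeasurable
  · rw [Real.norm_of_nonneg (by positivity)]
    have key : (1 + |v|) ^ N ≤ 2 ^ N * (1 + |v| ^ N) := by
      have ha : 0 ≤ |v| := abs_nonneg v
      have hvN : 0 ≤ |v| ^ N := by positivity
      rcases le_or_gt |v| 1 with h | h
      · calc (1 + |v|) ^ N ≤ 2 ^ N := pow_le_pow_left₀ (by positivity) (by linarith) N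
          _ = 2 ^ N * 1 := (mul_one _).symm
          _ ≤ 2 ^ N * (1 + |v| ^ N) := by gcongr; linarith
      · calc (1 + |v|) ^ N ≤ (2 * |v|) ^ N := pow_le_pow_left₀ (by positivity) (by linarith) N
          _ = 2 ^ N * |v| ^ N := mul_pow _ _ _
          _ ≤ 2 ^ N * (1 + |v| ^ N) := by gcongr; linarith
    calc (1 + |v|) ^ N * Real.exp (-b * v ^ 2)
        ≤ 2 ^ N * (1 + |v| ^ N) * Real.exp (-b * v ^ 2) := by gcongr
      _ = 2 ^ N * (Real.exp (-b * v ^ 2) + |v| ^ N * Real.exp (-b * v ^ 2)) := by ring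

/-! ### §2. The integrand `F(w) = L(s+w,ψ)L(s+w,ψχ)P^{(9/5)w}ω₁(w)/w` on the strip `|Re w| ≤ 2` -/

variable {D : ℕ} [NeZero D] (χ : DirichletCharacter ℂ D)

set_option maxHeartbeats 400000 in
/-- **A Gaussian majorant for the Lemma 4.4 Perron integrand on the closed strip.** For `D ≥ 3`,
`χ` primitive, `ψ (mod p) ∈ Ψ` and any `s`, there are `K, b > 0` and `N ∈ ℕ` with
`‖L(s+w,ψ)L(s+w,ψχ)P^{(9/5)w}ω₁(w)/w‖·|w| ≤ K(1+|v|)ᴺe^{−bv²}` for all `w = u + iv`, `|u| ≤ 2`, and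
`(1+|v|)ᴺe^{−bv²}` integrable — polynomial growth of both `L`-factors
(`StripGrowth.exists_norm_LFunction_le_pow`), `|P^{(9/5)w}| ≤ e^{(18/5)|log P|}`,
`|ω₁(u+iv)| = e^{(u²−v²)/4𝓛³⁰}`. [cite: Zhang2022LandauSiegel, §4 Lemma 4.4 (proof) p.19] -/
theorem exists_norm_perronLL_mul_le (hD : 3 ≤ D) (hχ : χ.IsPrimitive) (x : Chr D) (s : ℂ) :
    ∃ K b : ℝ, ∃ N : ℕ, 0 < K ∧ 0 < b ∧
      (∀ u : ℝ, |u| ≤ 2 → ∀ v : ℝ,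
        ‖perronIntegrand D (fun w => LL χ x (s + w)) ((u : ℂ) + (v : ℂ) * I)‖ *
            ‖(u : ℂ) + (v : ℂ) * I‖ ≤
          K * ((1 + |v|) ^ N * Real.exp (-b * v ^ 2))) ∧
      Integrable fun v : ℝ => K * ((1 + |v|) ^ N * Real.exp (-b * v ^ 2)) := by
  have hℓ : 0 < ell D := Real.log_pos (by exact_mod_cast (by omega : 1 < D))
  set Λ : ℝ := ell D ^ 30 with hΛ
  have hΛ0 : 0 < Λ := pow_pos hℓ 30
  have hP0 : 0 < bigP D := Real.exp_pos _
  -- polynomial growth of both `L`-factors on `|Re w| ≤ 2`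
  set A : ℕ := ⌈|s.re|⌉₊ + 2 with hAdef
  have hA1 : 1 ≤ A := by omega
  obtain ⟨C₁, hC₁, hL₁⟩ :=
    StripGrowth.exists_norm_LFunction_le_pow (θ := x.ψ) x.prim x.p_ne_one hA1
  have hprim₂ : (psiChi χ x).IsPrimitive := psiChiPrimitive_holds D χ x hD hχ
  have hk₂ : D * x.p ≠ 1 := by
    have hp : 2 ≤ x.p := x.prime.two_le
    have : 6 ≤ D * x.p := Nat.mul_le_mul hD hp
    omega
  obtain ⟨C₂, hC₂, hL₂⟩ :=
    StripGrowth.exists_norm_LFunction_le_pow (θ := psiChi χ x) hprim₂ hk₂ hA1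
  set N : ℕ := (A + 2) + (A + 2) with hNdef
  set b : ℝ := 1 / (4 * Λ) with hbdef
  have hb0 : 0 < b := by rw [hbdef]; positivity
  set K : ℝ := C₁ * (|s.im| + A + 1) ^ (A + 2) * (C₂ * (|s.im| + A + 1) ^ (A + 2)) *
      Real.exp (18 / 5 * |Real.log (bigP D)|) * Real.exp (4 / (4 * Λ)) with hKdef
  have hK0 : 0 < K := by rw [hKdef]; positivity
  refine ⟨K, b, N, hK0, hb0, fun u hu v => ?_,
    (integrable_one_add_abs_pow_mul_exp_neg_mul_sq hb0 N).const_mul K⟩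
  set w : ℂ := (u : ℂ) + (v : ℂ) * I with hwdef
  -- the two `L`-factors
  have hre : |(s + w).re| ≤ A := by
    have h1 : (s + w).re = s.re + u := by simp [hwdef]
    rw [h1]
    have h2 : |s.re| ≤ ⌈|s.re|⌉₊ := Nat.le_ceil _
    have h3 : (A : ℝ) = ⌈|s.re|⌉₊ + 2 := by rw [hAdef]; push_cast; ring
    rw [h3]
    calc |s.re + u| ≤ |s.re| + |u| := abs_add_le _ _
      _ ≤ ⌈|s.re|⌉₊ + 2 := add_le_add h2 hu
  have him : (s + w).im = s.im + v := by simp [hwdef]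
  have hA0 : (0 : ℝ) ≤ A := Nat.cast_nonneg A
  have hpoly : (|s.im + v| + A + 1) ^ (A + 2) ≤ (|s.im| + A + 1) ^ (A + 2) * (1 + |v|) ^ (A + 2) := by
    rw [← mul_pow]
    apply pow_le_pow_left₀ (by positivity)
    have h1 : |s.im + v| ≤ |s.im| + |v| := abs_add_le _ _
    have h2 : 0 ≤ |v| := abs_nonneg v
    nlinarith [abs_nonneg s.im]
  have hLb₁ : ‖x.ψ.LFunction (s + w)‖ ≤ C₁ * (|s.im| + A + 1) ^ (A + 2) * (1 + |v|) ^ (A + 2) := by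
    have h := hL₁ (s + w) hre
    rw [him] at h
    calc ‖x.ψ.LFunction (s + w)‖ ≤ C₁ * (|s.im + v| + A + 1) ^ (A + 2) := h
      _ ≤ C₁ * ((|s.im| + A + 1) ^ (A + 2) * (1 + |v|) ^ (A + 2)) := by gcongr
      _ = _ := by ring
  have hLb₂ : ‖(psiChi χ x).LFunction (s + w)‖ ≤
      C₂ * (|s.im| + A + 1) ^ (A + 2) * (1 + |v|) ^ (A + 2) := by
    have h := hL₂ (s + w) hre
    rw [him] at h
    calc ‖(psiChi χ x).LFunction (s + w)‖ ≤ C₂ * (|s.im + v| + A + 1) ^ (A + 2) := h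
      _ ≤ C₂ * ((|s.im| + A + 1) ^ (A + 2) * (1 + |v|) ^ (A + 2)) := by gcongr
      _ = _ := by ring
  have hLL : ‖LL χ x (s + w)‖ ≤ (C₁ * (|s.im| + A + 1) ^ (A + 2)) *
      (C₂ * (|s.im| + A + 1) ^ (A + 2)) * (1 + |v|) ^ N := by
    rw [LL, norm_mul, hNdef, pow_add]
    calc ‖x.ψ.LFunction (s + w)‖ * ‖(psiChi χ x).LFunction (s + w)‖
        ≤ (C₁ * (|s.im| + A + 1) ^ (A + 2) * (1 + |v|) ^ (A + 2)) *
          (C₂ * (|s.im| + A + 1) ^ (A + 2) * (1 + |v|) ^ (A + 2)) :=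
          mul_le_mul hLb₁ hLb₂ (norm_nonneg _) (by positivity)
      _ = _ := by ring
  -- `P^{(9/5)w}`
  have hPb : ‖(bigP D : ℂ) ^ ((9 / 5 : ℂ) * w)‖ ≤ Real.exp (18 / 5 * |Real.log (bigP D)|) := by
    rw [Complex.norm_cpow_eq_rpow_re_of_pos hP0]
    have h1 : ((9 / 5 : ℂ) * w).re = 9 / 5 * u := by simp [hwdef]
    rw [h1, Real.rpow_def_of_pos hP0]
    apply Real.exp_le_exp.mpr
    calc Real.log (bigP D) * (9 / 5 * u) ≤ |Real.log (bigP D) * (9 / 5 * u)| := le_abs_self _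
      _ = |Real.log (bigP D)| * (9 / 5 * |u|) := by
          rw [abs_mul, abs_mul, abs_of_pos (by norm_num : (0 : ℝ) < 9 / 5)]
      _ ≤ |Real.log (bigP D)| * (9 / 5 * 2) := by gcongr
      _ = 18 / 5 * |Real.log (bigP D)| := by ring
  -- `ω₁`
  have hωb : ‖omega1W D w‖ ≤ Real.exp (4 / (4 * Λ)) * Real.exp (-b * v ^ 2) := by
    rw [omega1W, ← hΛ, hwdef, GaussWeight.norm_omega1, ← Real.exp_add]
    apply Real.exp_le_exp.mpr
    rw [hbdef, sub_div]
    have h1 : u ^ 2 / (4 * Λ) ≤ 4 / (4 * Λ) := by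
      apply div_le_div_of_nonneg_right _ (by positivity)
      have := (abs_le.1 hu).1; have := (abs_le.1 hu).2; nlinarith
    have h2 : -(1 / (4 * Λ)) * v ^ 2 = -(v ^ 2 / (4 * Λ)) := by ring
    rw [h2]
    linarith
  -- assemble
  have hX0 : 0 ≤ (C₁ * (|s.im| + A + 1) ^ (A + 2)) * (C₂ * (|s.im| + A + 1) ^ (A + 2)) *
      (1 + |v|) ^ N := by positivity
  have hnum : ‖LL χ x (s + w) * (bigP D : ℂ) ^ ((9 / 5 : ℂ) * w) * omega1W D w‖ ≤
      K * ((1 + |v|) ^ N * Real.exp (-b * v ^ 2)) := by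
    rw [norm_mul, norm_mul]
    have h1 : ‖LL χ x (s + w)‖ * ‖(bigP D : ℂ) ^ ((9 / 5 : ℂ) * w)‖ ≤
        (C₁ * (|s.im| + A + 1) ^ (A + 2)) * (C₂ * (|s.im| + A + 1) ^ (A + 2)) * (1 + |v|) ^ N *
          Real.exp (18 / 5 * |Real.log (bigP D)|) :=
      mul_le_mul hLL hPb (norm_nonneg _) hX0
    have h2 := mul_le_mul h1 hωb (norm_nonneg _) (by positivity)
    refine h2.trans (le_of_eq ?_)
    rw [hKdef]; ring
  have hF : perronIntegrand D (fun w => LL χ x (s + w)) w =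
      LL χ x (s + w) * (bigP D : ℂ) ^ ((9 / 5 : ℂ) * w) * omega1W D w / w := by
    simp only [perronIntegrand]
  rw [hF, norm_div]
  rcases eq_or_ne w 0 with h0 | h0
  · rw [h0, norm_zero, mul_zero]
    positivity
  · rw [div_mul_cancel₀ _ (norm_ne_zero_iff.mpr h0)]
    exact hnum

/-- The Lemma 4.4 Perron integrand is continuous along every vertical line `Re w = u ≠ 0` (both
`L`-factors entire for the non-principal `ψ`, `ψχ`; `P^{(9/5)w}`, `ω₁` entire; `1/w` off `0`).
[cite: Zhang2022LandauSiegel, §4 Lemma 4.4 (proof) p.19] -/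
theorem continuous_perronLL_line (hD : 3 ≤ D) (hχ : χ.IsPrimitive) (x : Chr D) (s : ℂ) {u : ℝ}
    (hu0 : u ≠ 0) :
    Continuous fun v : ℝ =>
      perronIntegrand D (fun w => LL χ x (s + w)) ((u : ℂ) + (v : ℂ) * I) := by
  have hP0 : 0 < bigP D := Real.exp_pos _
  have hPne : (bigP D : ℂ) ≠ 0 := ofReal_ne_zero.mpr hP0.ne'
  have hne : ∀ v : ℝ, (u : ℂ) + (v : ℂ) * I ≠ 0 := by
    intro v h
    have := congrArg Complex.re h
    simp at this
    exact hu0 this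
  have hL : Continuous fun w : ℂ => LL χ x (s + w) := by
    have h1 : Differentiable ℂ fun w : ℂ => x.ψ.LFunction (s + w) :=
      (DirichletCharacter.differentiable_LFunction x.ψ_ne_one).comp (differentiable_id.const_add s)
    have h2 : Differentiable ℂ fun w : ℂ => (psiChi χ x).LFunction (s + w) :=
      (DirichletCharacter.differentiable_LFunction (psiChi_ne_one χ hD hχ x)).comp
        (differentiable_id.const_add s)
    exact (h1.mul h2).continuous
  have hPd : Continuous fun w : ℂ => (bigP D : ℂ) ^ ((9 / 5 : ℂ) * w) :=
    ((differentiable_id.const_mul _).const_cpow (Or.inl hPne)).continuous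
  have hω : Continuous (omega1W D) := by
    unfold omega1W GaussWeight.omega1; fun_prop
  have hline : Continuous fun v : ℝ => (u : ℂ) + (v : ℂ) * I := by fun_prop
  have h : Continuous fun v : ℝ => LL χ x (s + ((u : ℂ) + (v : ℂ) * I)) *
      (bigP D : ℂ) ^ ((9 / 5 : ℂ) * ((u : ℂ) + (v : ℂ) * I)) * omega1W D ((u : ℂ) + (v : ℂ) * I) /
        ((u : ℂ) + (v : ℂ) * I) :=
    (((hL.comp hline).mul (hPd.comp hline)).mul (hω.comp hline)).div hline hne
  exact h

/-- **Absolute convergence of `∫_{(u)} L(s+w,ψ)L(s+w,ψχ)P^{(9/5)w}ω₁(w)dw/w` for `0 < |u| ≤ 2`**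
(in particular on the two lines `u = 1`, `u = −σ − 1/2` of the proof of Lemma 4.4): `v ↦ F(u+iv)` is
integrable on `ℝ`. [cite: Zhang2022LandauSiegel, §4 Lemma 4.4 (proof) p.19] -/
theorem integrable_perronLL_line (hD : 3 ≤ D) (hχ : χ.IsPrimitive) (x : Chr D) (s : ℂ) {u : ℝ}
    (hu0 : u ≠ 0) (hu1 : |u| ≤ 2) :
    Integrable fun v : ℝ => perronIntegrand D (fun w => LL χ x (s + w)) ((u : ℂ) + (v : ℂ) * I) := by
  obtain ⟨K, b, N, hK0, hb0, hFb, hg⟩ := exists_norm_perronLL_mul_le χ hD hχ x s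
  have hu' : 0 < |u| := abs_pos.mpr hu0
  refine (hg.const_mul |u|⁻¹).mono'
    (continuous_perronLL_line χ hD hχ x s hu0).aestronglyMeasurable (ae_of_all _ fun v => ?_)
  have hw : |u| ≤ ‖(u : ℂ) + (v : ℂ) * I‖ := by
    calc |u| = |((u : ℂ) + (v : ℂ) * I).re| := by simp
      _ ≤ ‖(u : ℂ) + (v : ℂ) * I‖ := Complex.abs_re_le_norm _
  have hwpos : 0 < ‖(u : ℂ) + (v : ℂ) * I‖ := lt_of_lt_of_le hu' hw
  have h1 := hFb u hu1 v
  rw [← le_div_iff₀ hwpos] at h1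
  calc ‖perronIntegrand D (fun w => LL χ x (s + w)) ((u : ℂ) + (v : ℂ) * I)‖
      ≤ K * ((1 + |v|) ^ N * Real.exp (-b * v ^ 2)) / ‖(u : ℂ) + (v : ℂ) * I‖ := h1
    _ ≤ K * ((1 + |v|) ^ N * Real.exp (-b * v ^ 2)) / |u| :=
        div_le_div_of_nonneg_left (by positivity) hu' hw
    _ = |u|⁻¹ * (K * ((1 + |v|) ^ N * Real.exp (-b * v ^ 2))) := by ring

/-! ### §3. The contour shift -/

/-- **`Z22:§4.u025`, the identity for every admissible abscissa.** For `D ≥ 3`, `χ` primitive,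
`ψ (mod p) ∈ Ψ`, any `s ∈ ℂ` and any `σ₁` with `−2 ≤ σ₁ < 0`:
`(2πi)⁻¹∫_{(1)} F − (2πi)⁻¹∫_{(σ₁)} F = L(s,ψ)L(s,ψχ)`, `F(w) = L(s+w,ψ)L(s+w,ψχ)P^{(9/5)w}ω₁(w)/w`
("by the residue theorem": the only singularity between the lines is the simple pole of `1/w` at
`w = 0`, with residue `L(s,ψ)L(s,ψχ)P⁰ω₁(0) = L(s,ψ)L(s,ψχ)`; both line integrals converge
absolutely and the horizontal sides vanish in the limit by the Gaussian decay of `ω₁` against the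
polynomial growth of the two `L`-factors). [cite: Zhang2022LandauSiegel, §4 Lemma 4.4 (proof) p.19] -/
theorem perronLine_LL_one_sub_eq (hD : 3 ≤ D) (hχ : χ.IsPrimitive) (x : Chr D) (s : ℂ) {σ₁ : ℝ}
    (hσ₁ : σ₁ < 0) (hσ₂ : -2 ≤ σ₁) :
    perronLine D (fun w => LL χ x (s + w)) 1 - perronLine D (fun w => LL χ x (s + w)) σ₁
      = LL χ x s := by
  -- parameters
  have hP0 : 0 < bigP D := Real.exp_pos _
  have hPne : (bigP D : ℂ) ≠ 0 := ofReal_ne_zero.mpr hP0.ne'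
  set G : ℂ → ℂ := fun w => LL χ x (s + w) with hGdef
  -- the numerator `φ(w) = L(s+w,ψ)L(s+w,ψχ)P^{(9/5)w}ω₁(w)` and the integrand `F = φ/w`
  set φ : ℂ → ℂ := fun w =>
    LL χ x (s + w) * (bigP D : ℂ) ^ ((9 / 5 : ℂ) * w) * omega1W D w with hφdef
  have hF_eq : ∀ w : ℂ, perronIntegrand D G w = φ w / w := by
    intro w; simp only [perronIntegrand, hGdef, hφdef]
  have hL : Differentiable ℂ fun w : ℂ => LL χ x (s + w) := by
    have h1 : Differentiable ℂ fun w : ℂ => x.ψ.LFunction (s + w) :=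
      (DirichletCharacter.differentiable_LFunction x.ψ_ne_one).comp (differentiable_id.const_add s)
    have h2 : Differentiable ℂ fun w : ℂ => (psiChi χ x).LFunction (s + w) :=
      (DirichletCharacter.differentiable_LFunction (psiChi_ne_one χ hD hχ x)).comp
        (differentiable_id.const_add s)
    exact h1.mul h2
  have hPd : Differentiable ℂ fun w : ℂ => (bigP D : ℂ) ^ ((9 / 5 : ℂ) * w) :=
    (differentiable_id.const_mul _).const_cpow (Or.inl hPne)
  have hω : Differentiable ℂ (omega1W D) := by
    unfold omega1W GaussWeight.omega1; fun_prop
  have hφ : Differentiable ℂ φ := (hL.mul hPd).mul hω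
  -- the Gaussian majorant
  obtain ⟨K, b, N, hK0, hb0, hFb, hg⟩ := exists_norm_perronLL_mul_le χ hD hχ x s
  -- uniform decay on the horizontal segments `[σ₁, 1] × {±T}`
  have hdecay : ∀ ε : ℝ, 0 < ε → ∃ T₀ : ℝ, ∀ T : ℝ, T₀ ≤ |T| →
      ∀ u ∈ Icc σ₁ 1, ‖perronIntegrand D G ((u : ℂ) + (T : ℂ) * I)‖ ≤ ε := by
    refine Literature.Analysis.Complex.decay_of_bound (T₀ := 1)
      (g := fun T : ℝ => K * (2 ^ N / b ^ N) * ((b * T ^ 2) ^ N * Real.exp (-(b * T ^ 2))))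
      (fun T hT u hu => ?_) ?_
    · have hu : |u| ≤ 2 := abs_le.2 ⟨by linarith [hu.1], by linarith [hu.2]⟩
      have hw : 1 ≤ ‖(u : ℂ) + (T : ℂ) * I‖ := by
        calc (1 : ℝ) ≤ |T| := hT
          _ = |((u : ℂ) + (T : ℂ) * I).im| := by simp
          _ ≤ ‖(u : ℂ) + (T : ℂ) * I‖ := Complex.abs_im_le_norm _
      have h1 : ‖perronIntegrand D G ((u : ℂ) + (T : ℂ) * I)‖ ≤
          K * ((1 + |T|) ^ N * Real.exp (-b * T ^ 2)) := by
        have h := hFb u hu T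
        calc ‖perronIntegrand D G ((u : ℂ) + (T : ℂ) * I)‖
            = ‖perronIntegrand D G ((u : ℂ) + (T : ℂ) * I)‖ * 1 := (mul_one _).symm
          _ ≤ ‖perronIntegrand D G ((u : ℂ) + (T : ℂ) * I)‖ * ‖(u : ℂ) + (T : ℂ) * I‖ := by
              gcongr
          _ ≤ _ := h
      have hTsq : |T| ^ 2 = T ^ 2 := sq_abs T
      have h2 : (1 + |T|) ^ N ≤ 2 ^ N / b ^ N * (b * T ^ 2) ^ N := by
        have hbN : 0 < b ^ N := pow_pos hb0 N
        have e : 2 ^ N / b ^ N * (b * T ^ 2) ^ N = 2 ^ N * (T ^ 2) ^ N := by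
          rw [mul_pow]; field_simp
        rw [e]
        calc (1 + |T|) ^ N ≤ (2 * |T|) ^ N := pow_le_pow_left₀ (by positivity) (by linarith) N
          _ = 2 ^ N * |T| ^ N := mul_pow _ _ _
          _ ≤ 2 ^ N * (T ^ 2) ^ N := by
              gcongr
              calc |T| = |T| ^ 1 := (pow_one _).symm
                _ ≤ |T| ^ 2 := pow_le_pow_right₀ hT (by norm_num)
                _ = T ^ 2 := hTsq
      calc ‖perronIntegrand D G ((u : ℂ) + (T : ℂ) * I)‖
          ≤ K * ((1 + |T|) ^ N * Real.exp (-b * T ^ 2)) := h1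
        _ ≤ K * ((2 ^ N / b ^ N * (b * T ^ 2) ^ N) * Real.exp (-b * T ^ 2)) := by gcongr
        _ = K * (2 ^ N / b ^ N) * ((b * |T| ^ 2) ^ N * Real.exp (-(b * |T| ^ 2))) := by
            rw [hTsq]; ring
    · have h1 : Tendsto (fun T : ℝ => b * T ^ 2) atTop atTop :=
        (tendsto_pow_atTop two_ne_zero).const_mul_atTop hb0
      have h2 := (tendsto_pow_mul_exp_neg_atTop_nhds_zero N).comp h1
      have h3 := h2.const_mul (K * (2 ^ N / b ^ N))
      rw [mul_zero] at h3
      exact h3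
  -- the residue theorem for the two lines
  have hS : ∀ p ∈ ({0} : Finset ℂ), σ₁ < p.re ∧ p.re < (1 : ℝ) := by
    intro p hp; rw [Finset.mem_singleton] at hp; subst hp
    exact ⟨by simpa using hσ₁, by norm_num⟩
  have hFdiff : DifferentiableOn ℂ (perronIntegrand D G) (Set.univ \ ↑({0} : Finset ℂ)) := by
    have h1 : DifferentiableOn ℂ (fun w => φ w / w) (Set.univ \ ↑({0} : Finset ℂ)) :=
      hφ.differentiableOn.div differentiableOn_id fun w hw => by
        simpa using hw
    exact h1.congr fun w _ => hF_eq w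
  have hpole : ∀ p ∈ ({0} : Finset ℂ), ∃ V ∈ 𝓝 p, DifferentiableOn ℂ ((fun _ : ℂ => φ) p) V ∧
      ∀ z ∈ V, z ≠ p →
        perronIntegrand D G z = (fun _ : ℂ => φ) p z / (z - p) ^ ((fun _ : ℂ => 0) p + 1) := by
    intro p hp
    rw [Finset.mem_singleton] at hp
    subst hp
    refine ⟨Set.univ, univ_mem, hφ.differentiableOn, fun z _ _ => ?_⟩
    simp only [sub_zero, zero_add, pow_one]
    exact hF_eq z
  have hint1 : Integrable fun t : ℝ => perronIntegrand D G (((1 : ℝ) : ℂ) + (t : ℂ) * I) :=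
    integrable_perronLL_line χ hD hχ x s one_ne_zero (by norm_num)
  have hintσ : Integrable fun t : ℝ => perronIntegrand D G ((σ₁ : ℂ) + (t : ℂ) * I) :=
    integrable_perronLL_line χ hD hχ x s hσ₁.ne (abs_le.2 ⟨by linarith, by linarith⟩)
  have hσκ : σ₁ < (1 : ℝ) := by linarith
  have key := Literature.Analysis.Complex.integral_vertical_sub_eq_sum_of_poles
    (F := perronIntegrand D G) hσκ ({0} : Finset ℂ) (fun _ => 0)
    (fun _ => φ) Set.univ isOpen_univ (Set.subset_univ _) hS hFdiff hpole hint1 hintσ hdecay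
  -- the residue: `φ(0) = L(s,ψ)L(s,ψχ)`
  have hφ0 : φ 0 = LL χ x s := by
    rw [hφdef]
    simp only [add_zero, mul_zero, cpow_zero, mul_one]
    rw [omega1W, GaussWeight.omega1]
    simp
  simp only [Finset.sum_singleton, iteratedDeriv_zero, Nat.factorial_zero, Nat.cast_one,
    div_one, hφ0] at key
  -- conclude
  unfold perronLine
  set I₁ : ℂ := ∫ v : ℝ, perronIntegrand D G (((1 : ℝ) : ℂ) + (v : ℂ) * I) with hI₁
  set I₂ : ℂ := ∫ v : ℝ, perronIntegrand D G ((σ₁ : ℂ) + (v : ℂ) * I) with hI₂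
  have hπ : (π : ℂ) ≠ 0 := ofReal_ne_zero.mpr Real.pi_pos.ne'
  rw [sub_eq_iff_eq_add] at key
  rw [key]
  field_simp
  ring

/-- **`Z22:§4.u025` DISCHARGED** [Z22 p.19, tex L1050]. The typed claim `Section4.ResidueSplit` —
"By the residue theorem, `L(s,ψ)L(s,ψχ) = (2πi)⁻¹(∫_{(1)} − ∫_{(−σ−1/2)}) L(s+w,ψ)L(s+w,ψχ)
P^{(9/5)w}ω₁(w)dw/w`" for `ψ ∈ Ψ`, `s ∈ Ω₃`, eventually in `D` — holds (from
`perronLine_LL_one_sub_eq` with `σ₁ = −σ − 1/2 ∈ [−2, 0)` for `s ∈ Ω₃`, `D₀ = 3`).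
[cite: Zhang2022LandauSiegel, §4 Lemma 4.4 (proof) p.19] -/
theorem residueSplit_holds : ResidueSplit := by
  refine ⟨⌈Real.exp 3⌉₊, fun D _ χ hD _ hχ x s hs => ?_⟩
  obtain ⟨h1, h2, -⟩ := hs
  have hL3 : 3 ≤ ell D := by
    have h : Real.exp 3 ≤ D := le_trans (Nat.le_ceil _) (by exact_mod_cast hD)
    exact (Real.le_log_iff_exp_le (lt_of_lt_of_le (Real.exp_pos _) h)).mpr h
  have hD3 : 3 ≤ D := by
    by_contra h
    push Not at h
    have h2' : (D : ℝ) ≤ 2 := by exact_mod_cast Nat.lt_succ_iff.mp h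
    have : ell D ≤ Real.log 2 := by
      rcases Nat.eq_zero_or_pos D with h0 | h0
      · rw [ell, h0, Nat.cast_zero, Real.log_zero]; exact Real.log_nonneg one_le_two
      · exact Real.log_le_log (by exact_mod_cast h0) h2'
    linarith [Real.log_two_lt_d9]
  have hα1 : alpha D ≤ 1 / 2 := by
    rw [alpha, bigP, Real.log_exp]
    have hL9 : (3 : ℝ) ^ 9 ≤ ell D ^ 9 := pow_le_pow_left₀ (by norm_num) hL3 9
    rw [div_le_iff₀ (by positivity)]
    nlinarith [Real.pi_lt_four]
  have hσ₁ : -s.re - 1 / 2 < 0 := by linarith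
  have hσ₂ : -2 ≤ -s.re - 1 / 2 := by linarith
  exact (perronLine_LL_one_sub_eq χ hD3 hχ x s hσ₁ hσ₂).symm

end Literature.NumberTheory.LFunctions.Zhang2022.Section4ResidueShift
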